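import Summits.CriticalPhenomena.PercolationContinuityZ3.Theorems.PercAnnulusCrossingIICAspectLevelJunk
import Summits.CriticalPhenomena.PercolationContinuityZ3.Theorems.PercAnnulusCrossingIICLevelTwoSided
import HarnessLib

/-!
# Kesten–Basu–Sapozhnikov IIC scheme in boxes at a GENERAL ASPECT, VII′: the two-sided one-level decomposition (lane RSW3, p1 gen 4)

builds on p205010 (kernel theorem, internal audit signed; external expert review pending)

Seat `prim-rsw3-p1` (gen 4).  General-aspect companion of part VII (`PercAnnulusCrossingIICLevelTwoSided.lean`): (A2)□ with an abstract
middle-sphere map `σ` and outer-radius map `τ` (`m < σ m < τ m` for `m ≥ 1`; `σ = (s·)`, `τ = (L·)` is `Crossing.SetToSetQuasiMultAspectAt d p s L ϰ`).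
Helper file; no definitions, no sorries; every `p`, `d`.  Proof = part VII verbatim with `2m ↦ σ m`, `4m ↦ τ m` (the deterministic half
`real_inter_conn_diff_good_le` of part VII is aspect-free and reused).
* **`sum_real_level_two_sided_aspect`** — annulus `(a,b) = (σ m₁, σ m₂)` (`m₁ ≤ m₂`, `τ m₁ < b`, `τ m₂ < n`), inner data `H ⊆ Λ(m₁−1)`, `X ⊆ Λ(m₁)`,
  `E` determined inside `Λ(a)`:  `P(E ∩ CONN) − ϰ⁻² α(a,b) P(CONN) ≤ Σ_{(U,R)} P(E ∩ DAT ∩ LINK' ∩ LEFT) · P(CONN(U,R;n)) ≤ P(E ∩ CONN)`.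
References: D. Basu, A. Sapozhnikov, ECP 22 (2017) no. 26, §2 (2.5)–(2.6).
-/

noncomputable section

namespace Summit.CriticalPhenomena.PercolationContinuityZ3.Theorems.Crossing

open MeasureTheory Literature.Probability.Percolation Literature.Probability.LatticeModels
open Literature.Probability.Percolation.DCT16
open Summit.CriticalPhenomena.PercolationContinuityZ3.Theorems.SurfaceTension
open scoped Literature.Probability.Percolation

variable {d : ℕ}

/-- **The two-sided one-level decomposition at a general aspect** (Basu–Sapozhnikov (2.5)/(2.6) with hole and source, Bernoulli case,
under (A2)□(ϰ) with middle spheres `∂ⁱⁿΛ(σ m)` and outer boxes `Λ(τ m)`).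
[cite: BasuSapozhnikov2017ECP, §2 eqs. (2.5)–(2.6)] -/
theorem sum_real_level_two_sided_aspect (p : unitInterval) {ϰ : ℝ} (hϰ : 0 < ϰ)
    {σ τ : ℕ → ℕ} (hσ : ∀ m : ℕ, 1 ≤ m → m < σ m) (hστ : ∀ m : ℕ, 1 ≤ m → σ m < τ m)
    (hA2 : ∀ m : ℕ, 1 ≤ m → ∀ Z : Finset (Site d), box d (τ m) \ box d (m - 1) ⊆ Z →
      ∀ X : Finset (Site d), X ⊆ Z ∩ box d m → ∀ Y : Finset (Site d), Y ⊆ Z \ box d (τ m) →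
        ϰ * (bondPercolation (zdGraph d) p).real {ω | ∃ x ∈ X, ∃ s ∈ innerBoundary (zdGraph d) (box d (σ m)),
              ω ∈ openConnIn (↑Z : Set (Site d)) x s} *
          (bondPercolation (zdGraph d) p).real {ω | ∃ y ∈ Y, ∃ s ∈ innerBoundary (zdGraph d) (box d (σ m)),
              ω ∈ openConnIn (↑Z : Set (Site d)) y s} ≤
        (bondPercolation (zdGraph d) p).real {ω | ∃ x ∈ X, ∃ y ∈ Y, ω ∈ openConnIn (↑Z : Set (Site d)) x y})
    {m₁ m₂ n : ℕ} (hm₁ : 1 ≤ m₁) (hm₁₂ : m₁ ≤ m₂) (h12 : τ m₁ < σ m₂) (hn : τ m₂ < n)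
    {H X : Finset (Site d)} (hH : H ⊆ box d (m₁ - 1)) (hX : X ⊆ box d m₁) (hXH : ∀ x ∈ X, x ∉ H)
    {E : Set (BondConfig (Site d))} {F : Finset (Sym2 (Site d))} (hE : DeterminedBy E ↑F) (hF : F ⊆ (box d (σ m₁)).sym2) :
    (bondPercolation (zdGraph d) p).real (E ∩ {ω : BondConfig (Site d) | ∃ x ∈ X, ∃ t ∈ innerBoundary (zdGraph d) (box d n),
          ω ∈ openConnIn ((↑(box d n) : Set (Site d)) \ ↑H) x t}) -
        ϰ⁻¹ ^ 2 * (bondPercolation (zdGraph d) p).real (boxCrossing d (σ m₁) (σ m₂)) *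
          (bondPercolation (zdGraph d) p).real {ω : BondConfig (Site d) | ∃ x ∈ X, ∃ t ∈ innerBoundary (zdGraph d) (box d n),
            ω ∈ openConnIn ((↑(box d n) : Set (Site d)) \ ↑H) x t} ≤
      ∑ UR ∈ ((box d (σ m₂)).powerset.filter (fun U => box d (σ m₁) ⊆ U)) ×ˢ (box d (σ m₂ + 1)).powerset,
        (bondPercolation (zdGraph d) p).real (E ∩
          {ω | ω ∩ (↑((box d (σ m₂ + 1)).sym2) : Set (Sym2 (Site d))) ∈
            explEvent (↑(box d (σ m₁)) : Set (Site d)) ((↑(box d (σ m₂)) : Set (Site d)) \ ↑(box d (σ m₁))) ↑UR.1 ↑UR.2} ∩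
          {ω | ∀ r ∈ UR.2, ∀ r' ∈ UR.2, ∃ v ∈ UR.1, ∃ v' ∈ UR.1,
            s(v, r) ∈ ω ∧ s(v', r') ∈ ω ∧ ω ∈ openConnIn ((↑UR.1 : Set (Site d)) \ ↑(box d (σ m₁ - 1))) v v'} ∩
          {ω | ∃ x ∈ X, ∃ r ∈ UR.2, ∃ v ∈ UR.1, ω ∈ openConnIn ((↑UR.1 : Set (Site d)) \ ↑H) x v ∧ s(v, r) ∈ ω}) *
        (bondPercolation (zdGraph d) p).real {ω : BondConfig (Site d) | ∃ r ∈ UR.2, ∃ t ∈ innerBoundary (zdGraph d) (box d n),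
            ω ∈ openConnIn ((↑(box d n) : Set (Site d)) \ ↑UR.1) r t} ∧
    ∑ UR ∈ ((box d (σ m₂)).powerset.filter (fun U => box d (σ m₁) ⊆ U)) ×ˢ (box d (σ m₂ + 1)).powerset,
        (bondPercolation (zdGraph d) p).real (E ∩
          {ω | ω ∩ (↑((box d (σ m₂ + 1)).sym2) : Set (Sym2 (Site d))) ∈
            explEvent (↑(box d (σ m₁)) : Set (Site d)) ((↑(box d (σ m₂)) : Set (Site d)) \ ↑(box d (σ m₁))) ↑UR.1 ↑UR.2} ∩
          {ω | ∀ r ∈ UR.2, ∀ r' ∈ UR.2, ∃ v ∈ UR.1, ∃ v' ∈ UR.1,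
            s(v, r) ∈ ω ∧ s(v', r') ∈ ω ∧ ω ∈ openConnIn ((↑UR.1 : Set (Site d)) \ ↑(box d (σ m₁ - 1))) v v'} ∩
          {ω | ∃ x ∈ X, ∃ r ∈ UR.2, ∃ v ∈ UR.1, ω ∈ openConnIn ((↑UR.1 : Set (Site d)) \ ↑H) x v ∧ s(v, r) ∈ ω}) *
        (bondPercolation (zdGraph d) p).real {ω : BondConfig (Site d) | ∃ r ∈ UR.2, ∃ t ∈ innerBoundary (zdGraph d) (box d n),
            ω ∈ openConnIn ((↑(box d n) : Set (Site d)) \ ↑UR.1) r t} ≤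
      (bondPercolation (zdGraph d) p).real (E ∩ {ω : BondConfig (Site d) | ∃ x ∈ X, ∃ t ∈ innerBoundary (zdGraph d) (box d n),
          ω ∈ openConnIn ((↑(box d n) : Set (Site d)) \ ↑H) x t}) := by
  classical
  have hσ1 := hσ m₁ hm₁
  have hστ1 := hστ m₁ hm₁
  have hσ2 := hσ m₂ (by omega)
  have hστ2 := hστ m₂ (by omega)
  set μ := bondPercolation (zdGraph d) p with hμ
  set a := σ m₁ with ha
  set b := σ m₂ with hb
  have ha1 : 1 ≤ a := by omega
  have hab : a ≤ b := by omega
  have hab1 : a ≤ b - 1 := by omega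
  have hbn : b + 1 < n := by omega
  have hHa : H ⊆ box d (a - 1) := hH.trans (box_mono d (by omega))
  have hXa : X ⊆ box d a := hX.trans (box_mono d (by omega))
  set CONN := {ω : BondConfig (Site d) | ∃ x ∈ X, ∃ t ∈ innerBoundary (zdGraph d) (box d n),
    ω ∈ openConnIn ((↑(box d n) : Set (Site d)) \ ↑H) x t} with hCONN
  set 𝒟 := ((box d b).powerset.filter (fun U => box d a ⊆ U)) ×ˢ (box d (b + 1)).powerset with h𝒟
  set GOOD := ⋃ UR ∈ 𝒟, ({ω : BondConfig (Site d) | ω ∩ (↑((box d (b + 1)).sym2) : Set (Sym2 (Site d))) ∈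
      explEvent (↑(box d a) : Set (Site d)) ((↑(box d b) : Set (Site d)) \ ↑(box d a)) ↑UR.1 ↑UR.2} ∩
    {ω | ∀ r ∈ UR.2, ∀ r' ∈ UR.2, ∃ v ∈ UR.1, ∃ v' ∈ UR.1,
      s(v, r) ∈ ω ∧ s(v', r') ∈ ω ∧ ω ∈ openConnIn ((↑UR.1 : Set (Site d)) \ ↑(box d (a - 1))) v v'}) with hGOOD
  have hsum := sum_real_level_eq p hab hbn hHa hXa hE hF
  -- `hsum : Σ = μ.real (E ∩ CONN ∩ GOOD)`
  have hjunk := real_conn_inter_nonuniq_le_of_setToSetQM_aspect (d := d) p hϰ.le hσ hστ hA2 hm₁ hm₁₂ h12 hn hH hX hXH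
  have hdiff := real_inter_conn_diff_good_le (d := d) p (n := n) ha1 hab1 H X E
  have hϰ2 : 0 < ϰ ^ 2 := by positivity
  have hNU : μ.real ((E ∩ CONN) \ GOOD) ≤ ϰ⁻¹ ^ 2 * μ.real (boxCrossing d a b) * μ.real CONN := by
    refine hdiff.trans ?_
    rw [inv_pow, mul_assoc]
    exact (le_inv_mul_iff₀ hϰ2).2 hjunk
  constructor
  · rw [hsum]
    have hsplit : μ.real (E ∩ CONN) ≤ μ.real (E ∩ CONN ∩ GOOD) + μ.real ((E ∩ CONN) \ GOOD) := by
      calc μ.real (E ∩ CONN) = μ.real ((E ∩ CONN ∩ GOOD) ∪ ((E ∩ CONN) \ GOOD)) := by rw [Set.inter_union_sdiff]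
        _ ≤ _ := measureReal_union_le _ _
    linarith
  · rw [hsum]
    exact measureReal_mono (fun ω h => h.1) (measure_ne_top _ _)

end Summit.CriticalPhenomena.PercolationContinuityZ3.Theorems.Crossing

end
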